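import Literature.Geometry.Symplectic.FoldFormsFourFoldsGlueAssembly
import Literature.Geometry.Symplectic.SteinBoundaryContactCondition
import Literature.Geometry.Symplectic.PlanarContactBoundary
import Literature.Geometry.Symplectic.EtnyrePlanarFilling
import Literature.Topology.FourManifolds.CerfGammaFourProofs
import Literature.Topology.FourManifolds.GluingProofs
import Literature.Geometry.Symplectic.KahlerDecomposition
import HarnessLib

/-!
# Fold-forms for four-folds — Baykur's Stein gluing and Theorem 2 from the Kähler decomposition

Conclusion of the formalisation of Baykur's proof of Cannas da Silva's Theorem 2
([cite: Baykur2006, Thm. 6.1]; [cite: Cannasdasilva2010, Thm. 2]) begun in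
`FoldFormsFourFoldsProofs.lean`, `FoldFormsFourFoldsGlueProofs.lean` and
`FoldFormsFourFoldsGlueAssembly.lean`: the seam primitive of the Stein gluing read flat, the
re-indexed second piece with its conformal factor and sign, the rescaled interior Kähler forms,
the compatibility of the push-forwards on the two overlaps, the folded form on the model gluing
`P = W₁ ∪ (H × ℝ) ∪ W₂` of two Stein domains, and the target statement
`CannasDaSilva2010_foldedForm_of_orientable` from the tree's named fact
`baykur_kahlerDecomposition` ([cite: Baykur2006, Thm. 5.1]).

## Main statements

* Section `SeamGluePrimitive` — `seamGluePrimitive δ K α₁ α₂ β = ρ₊(s) α₁ + ρ₀(s)(K - s²) π^*β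
  + ρ₊(-s) α₂`; `flatRep_seamGluePrimitive` (it reads flat as the general fold primitive with
  profile `gluedProfile δ K F₁ F₂`); `seamGluePrimitive_flatData` (the flat data required by
  `def_one_gluedForm`, from the two flat bundles).
* Section `ConformalSign` — `reindexBoundaryData b₂ ψ` (carrier `H`, inclusion `incl₂ ∘ ψ`);
  `boundaryContactForm_eq_zero_iff_of_plane` (equal kernels under the plane-field clause);
  `exists_conformal_sign` (`β₂' = g β₁`, the sign `ε`, a bound); `signExtension` (the sign
  extended component-wise to `W₂`) with `signExtension_incl` (it restricts to the sign of `g`: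
  every component of a Stein domain has connected boundary, [cite: Etnyre2004, Thm. 4.1]).
* Section `InteriorForms` — `SteinStructure.interiorKahler ρ = d((ρ ∘ val) λ|_{W-∂W})` and its
  package (smooth, closed, non-degenerate, `= ρ · val^*ω`), `InteriorManifold.injective_mfderiv_val`.
* Section `Stitch` — the Stein glue datum `steinGlueData` (Liouville open collars, identity of
  `H`), `stitch_compat_M`, `stitch_compat_N` (compatibility of the push-forwards on the overlaps
  `s > 2δ`, `s < -2δ`), and **`exists_def_one_steinGlue`**: the model gluing carries a smooth
  closed `2`-form satisfying the transversality and maximal-rank clauses of Def. 1 along its fold.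
* Section `FromKahlerDecomposition` —
  **`cannasDaSilva2010_foldedForm_of_orientable_of_kahlerDecomposition`**:
  `baykur_kahlerDecomposition → CannasDaSilva2010_foldedForm_of_orientable`.
-/

noncomputable section

open scoped Manifold ContDiff Topology
open Set Function Filter
open Literature.Geometry.Kaehler Literature.Topology.FourManifolds

namespace Literature.Geometry.Symplectic

section SeamGluePrimitive

variable {H : Type*} [TopologicalSpace H] [ChartedSpace (EuclideanSpace ℝ (Fin 3)) H]
  [IsManifold (𝓡 3) ∞ H]

/-- **The seam primitive** `Λ = ρ₊(s) α₁ + (1 - ρ₊(s) - ρ₊(-s)) (K - s²) π^*β + ρ₊(-s) α₂` on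
`H × ℝ`. [cite: Baykur2006, proof of Thm. 6.1] -/
def seamGluePrimitive (δ K : ℝ) (α₁ α₂ : MForm ((𝓡 3).prod 𝓘(ℝ, ℝ)) (H × ℝ) ℝ 1)
    (β : MForm (𝓡 3) H ℝ 1) : MForm ((𝓡 3).prod 𝓘(ℝ, ℝ)) (H × ℝ) ℝ 1 :=
  (fun p : H × ℝ => cutPlus δ p.2) • α₁ +
    (fun p : H × ℝ => (1 - cutPlus δ p.2 - cutPlus δ (-p.2)) * (K - p.2 ^ 2)) • sliceForm β +
    (fun p : H × ℝ => cutPlus δ (-p.2)) • α₂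

omit [IsManifold (𝓡 3) ∞ H] in
/-- Pointwise unfolding of the seam primitive. [folklore] -/
theorem seamGluePrimitive_apply (δ K : ℝ) (α₁ α₂ : MForm ((𝓡 3).prod 𝓘(ℝ, ℝ)) (H × ℝ) ℝ 1)
    (β : MForm (𝓡 3) H ℝ 1) (p : H × ℝ) :
    seamGluePrimitive δ K α₁ α₂ β p = cutPlus δ p.2 • α₁ p +
      ((1 - cutPlus δ p.2 - cutPlus δ (-p.2)) * (K - p.2 ^ 2)) • sliceForm β p +
      cutPlus δ (-p.2) • α₂ p :=
  rfl

omit [IsManifold (𝓡 3) ∞ H] in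
/-- The flat representative is additive. [folklore] -/
theorem flatRep_add {k : ℕ} (α α' : MForm ((𝓡 3).prod 𝓘(ℝ, ℝ)) (H × ℝ) ℝ k) (h₀ : H)
    (u : EuclideanSpace ℝ (Fin 4)) : flatRep (α + α') h₀ u = flatRep α h₀ u + flatRep α' h₀ u :=
  rfl

omit [IsManifold (𝓡 3) ∞ H] in
/-- The flat representative of a function multiple. [folklore] -/
theorem flatRep_fun_smul {k : ℕ} (f : H × ℝ → ℝ) (α : MForm ((𝓡 3).prod 𝓘(ℝ, ℝ)) (H × ℝ) ℝ k)
    (h₀ : H) (u : EuclideanSpace ℝ (Fin 4)) :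
    flatRep (f • α) h₀ u = f (seamChartInv h₀ u) • flatRep α h₀ u := by
  ext w
  rfl

omit [IsManifold (𝓡 3) ∞ H] in
/-- The second coordinate of the inverse product chart is `u₀`. [folklore] -/
theorem seamChartInv_snd (h₀ : H) (u : EuclideanSpace ℝ (Fin 4)) : (seamChartInv h₀ u).2 = u 0 := rfl

/-- Expansion of the general fold primitive with the glued profile. [folklore] -/
theorem genFoldPrimitive_gluedProfile (δ K : ℝ) (F₁ F₂ : EuclideanSpace ℝ (Fin 4) → ℝ)
    (b : EuclideanSpace ℝ (Fin 4) → EuclideanSpace ℝ (Fin 4) →L[ℝ] ℝ) (u : EuclideanSpace ℝ (Fin 4)) :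
    genFoldPrimitive (gluedProfile δ K F₁ F₂) b u =
      cutPlus δ (u 0) • genFoldPrimitive F₁ b u +
        ((1 - cutPlus δ (u 0) - cutPlus δ (-(u 0))) * (K - (u 0) ^ 2)) • covectorToOneForm (b u) +
        cutPlus δ (-(u 0)) • genFoldPrimitive F₂ b u := by
  simp only [genFoldPrimitive, gluedProfile, smul_smul, ← add_smul]

/-- **The seam primitive read flat is the general fold primitive with the glued profile**:
`flatRep Λ = (ρ₊ F₁ + ρ₀ (K - u₀²) + ρ₋ F₂) b̂` over the chart target, when `α₁` reads `F₁ b̂` for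
`u₀ > 0` and `α₂` reads `F₂ b̂` for `u₀ < 0`. [cite: Baykur2006, proof of Thm. 6.1] -/
theorem flatRep_seamGluePrimitive {δ K : ℝ} (hδ : 0 < δ)
    {α₁ α₂ : MForm ((𝓡 3).prod 𝓘(ℝ, ℝ)) (H × ℝ) ℝ 1} {β : MForm (𝓡 3) H ℝ 1} (h₀ : H)
    {F₁ F₂ : EuclideanSpace ℝ (Fin 4) → ℝ}
    (h1 : ∀ u, sliceTail u ∈ (extChartAt (𝓡 3) h₀).target → 0 < u 0 →
      flatRep α₁ h₀ u = genFoldPrimitive F₁ (flatSliceCovector β h₀) u)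
    (h2 : ∀ u, sliceTail u ∈ (extChartAt (𝓡 3) h₀).target → u 0 < 0 →
      flatRep α₂ h₀ u = genFoldPrimitive F₂ (flatSliceCovector β h₀) u)
    {u : EuclideanSpace ℝ (Fin 4)} (hu : sliceTail u ∈ (extChartAt (𝓡 3) h₀).target) :
    flatRep (seamGluePrimitive δ K α₁ α₂ β) h₀ u =
      genFoldPrimitive (gluedProfile δ K F₁ F₂) (flatSliceCovector β h₀) u := by
  rw [genFoldPrimitive_gluedProfile, seamGluePrimitive, flatRep_add, flatRep_add, flatRep_fun_smul,
    flatRep_fun_smul, flatRep_fun_smul, flatRep_sliceForm β h₀ hu]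
  simp only [seamChartInv_snd]
  rcases lt_trichotomy (u 0) 0 with hneg | hzero | hpos
  · have hρ : cutPlus δ (u 0) = 0 := cutPlus_of_le hδ (by linarith)
    rw [h2 u hu hneg, hρ]
    simp only [zero_smul, zero_add]
    rfl
  · have hρ : cutPlus δ (u 0) = 0 := cutPlus_of_le hδ (by linarith)
    have hρ' : cutPlus δ (-(u 0)) = 0 := cutPlus_of_le hδ (by linarith)
    rw [hρ, hρ']
    simp only [zero_smul, zero_add, add_zero]
    rfl
  · have hρ' : cutPlus δ (-(u 0)) = 0 := cutPlus_of_le hδ (by linarith)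
    rw [h1 u hu hpos, hρ']
    simp only [zero_smul, add_zero]
    rfl

omit [IsManifold (𝓡 3) ∞ H] in
/-- The product chart's collar coordinate. [folklore] -/
theorem seamChart_apply_zero (h₀ : H) (p : H × ℝ) : seamChart h₀ p 0 = p.2 :=
  consCLE_apply_zero' _ _

/-- **The flat data of the seam primitive for `def_one_gluedForm`.**  Given the two flat
bundles (`α₁` reads `F₁ b̂` on `U⁺` with `F₁` smooth, positive, `≤ B`, `∂₀F₁ < 0`; `α₂` reads
`F₂ b̂` on `U⁻` with `F₂` smooth, positive, `≤ B`, `∂₀F₂ > 0`), a smooth `β` whose flat slice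
covectors have non-zero slice contact volume, `δ > 0` and `K > B + 4δ²`: over every seam point
the seam primitive reads flat as `Φ̂ b̂` with `Φ̂ = gluedProfile δ K F₁ F₂` smooth, `b̂ ⟂ e₀`, and
the fold data at parameter `0` / the symplectic data at parameter `≠ 0`.
[cite: Baykur2006, proof of Thm. 6.1] -/
theorem seamGluePrimitive_flatData {δ K B : ℝ} (hδ : 0 < δ) (hK : B + 4 * δ ^ 2 < K) (hB : 0 ≤ B)
    {α₁ α₂ : MForm ((𝓡 3).prod 𝓘(ℝ, ℝ)) (H × ℝ) ℝ 1} {β : MForm (𝓡 3) H ℝ 1} (hβ : IsSmoothForm β)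
    (hvol : ∀ (h₀ : H) (u : EuclideanSpace ℝ (Fin 4)), sliceTail u ∈ (extChartAt (𝓡 3) h₀).target →
      sliceContactVolume (flatSliceCovector β h₀ u) (fderiv ℝ (flatSliceCovector β h₀) u) ≠ 0)
    {F₁ F₂ : H → EuclideanSpace ℝ (Fin 4) → ℝ}
    (hF₁ : ∀ h₀ : H, ContDiffOn ℝ ∞ (F₁ h₀) {u | sliceTail u ∈ (extChartAt (𝓡 3) h₀).target ∧ 0 < u 0} ∧
      ∀ u, sliceTail u ∈ (extChartAt (𝓡 3) h₀).target → 0 < u 0 →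
        0 < F₁ h₀ u ∧ F₁ h₀ u ≤ B ∧ fderiv ℝ (F₁ h₀) u (stdVec 0) < 0 ∧
        flatRep α₁ h₀ u = genFoldPrimitive (F₁ h₀) (flatSliceCovector β h₀) u)
    (hF₂ : ∀ h₀ : H, ContDiffOn ℝ ∞ (F₂ h₀) {u | sliceTail u ∈ (extChartAt (𝓡 3) h₀).target ∧ u 0 < 0} ∧
      ∀ u, sliceTail u ∈ (extChartAt (𝓡 3) h₀).target → u 0 < 0 →
        0 < F₂ h₀ u ∧ F₂ h₀ u ≤ B ∧ 0 < fderiv ℝ (F₂ h₀) u (stdVec 0) ∧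
        flatRep α₂ h₀ u = genFoldPrimitive (F₂ h₀) (flatSliceCovector β h₀) u)
    (p : H × ℝ) :
    ∃ (Φ : EuclideanSpace ℝ (Fin 4) → ℝ)
      (b : EuclideanSpace ℝ (Fin 4) → EuclideanSpace ℝ (Fin 4) →L[ℝ] ℝ),
      ContDiffOn ℝ ∞ Φ {u | sliceTail u ∈ (extChartAt (𝓡 3) p.1).target} ∧
      ContDiffOn ℝ ∞ b {u | sliceTail u ∈ (extChartAt (𝓡 3) p.1).target} ∧
      (∀ u, sliceTail u ∈ (extChartAt (𝓡 3) p.1).target → b u (stdVec 0) = 0) ∧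
      (∀ u, sliceTail u ∈ (extChartAt (𝓡 3) p.1).target → fderiv ℝ b u (stdVec 0) = 0) ∧
      (∀ u, sliceTail u ∈ (extChartAt (𝓡 3) p.1).target →
        flatRep (seamGluePrimitive δ K α₁ α₂ β) p.1 u = genFoldPrimitive Φ b u) ∧
      ((fderiv ℝ Φ (seamChart p.1 p) (stdVec 0) = 0 ∧ Φ (seamChart p.1 p) ≠ 0 ∧
          fderiv ℝ (fun y => fderiv ℝ Φ y (stdVec 0)) (seamChart p.1 p) (stdVec 0) ≠ 0 ∧
          sliceContactVolume (b (seamChart p.1 p)) (fderiv ℝ b (seamChart p.1 p)) ≠ 0) ∨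
        pfaffian (genContactFoldForm Φ b (seamChart p.1 p)) ≠ 0) := by
  set h₀ := p.1 with hh₀
  set O : Set (EuclideanSpace ℝ (Fin 4)) := {u | sliceTail u ∈ (extChartAt (𝓡 3) h₀).target} with hOdef
  have hO : IsOpen O := isOpen_sliceTail_preimage_target (H := H) h₀
  obtain ⟨hF₁c, hF₁p⟩ := hF₁ h₀
  obtain ⟨hF₂c, hF₂p⟩ := hF₂ h₀
  have hΦ : ContDiffOn ℝ ∞ (gluedProfile δ K (F₁ h₀) (F₂ h₀)) O :=
    contDiffOn_gluedProfile hδ (isOpen_extChartAt_target (I := 𝓡 3) h₀) hF₁c hF₂c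
  have hb : ContDiffOn ℝ ∞ (flatSliceCovector β h₀) O := contDiffOn_flatSliceCovector hβ h₀
  have hb0 : ∀ u ∈ O, flatSliceCovector β h₀ u (stdVec 0) = 0 := fun u _ =>
    flatSliceCovector_stdVec_zero β h₀ u
  have hb1 : ∀ u ∈ O, fderiv ℝ (flatSliceCovector β h₀) u (stdVec 0) = 0 := fun u _ =>
    fderiv_flatSliceCovector_stdVec_zero β h₀ u
  have hrep : ∀ u ∈ O, flatRep (seamGluePrimitive δ K α₁ α₂ β) h₀ u =
      genFoldPrimitive (gluedProfile δ K (F₁ h₀) (F₂ h₀)) (flatSliceCovector β h₀) u := fun u hu =>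
    flatRep_seamGluePrimitive hδ h₀ (fun u hu hu0 => (hF₁p u hu hu0).2.2.2)
      (fun u hu hu0 => (hF₂p u hu hu0).2.2.2) hu
  refine ⟨gluedProfile δ K (F₁ h₀) (F₂ h₀), flatSliceCovector β h₀, hΦ, hb, hb0, hb1, hrep, ?_⟩
  -- the point `u = κ p`, `u₀ = p.2`
  set u := seamChart h₀ p with hudef
  have huO : u ∈ O := seamChart_mem_preimage_target h₀ (mem_chart_source _ p.1)
  have hu0 : u 0 = p.2 := seamChart_apply_zero h₀ p
  by_cases hp : p.2 = 0
  · left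
    obtain ⟨h1, h2, h3⟩ := gluedProfile_seam (K := K) (F₁ := F₁ h₀) (F₂ := F₂ h₀) hδ (u := u)
      (by rw [hu0, hp])
    refine ⟨h1, ?_, ?_, hvol h₀ u huO⟩
    · rw [h2]; nlinarith [sq_nonneg δ]
    · rw [h3]; norm_num
  · right
    refine Eq.trans_ne (pfaffian_genContactFoldForm_eqOn hO (hΦ.differentiableOn (by simp))
      (hb.differentiableOn (by simp)) hb0 hb1 huO) ?_
    have hΦd : DifferentiableAt ℝ (gluedProfile δ K (F₁ h₀) (F₂ h₀)) u :=
      ((hΦ u huO).contDiffAt (hO.mem_nhds huO)).differentiableAt (by simp)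
    rcases lt_or_gt_of_ne hp with hneg | hpos
    · have hu0' : u 0 < 0 := by rw [hu0]; exact hneg
      obtain ⟨hpos', hle, hder, -⟩ := hF₂p u huO hu0'
      have hU : IsOpen {u : EuclideanSpace ℝ (Fin 4) | sliceTail u ∈ (extChartAt (𝓡 3) h₀).target ∧ u 0 < 0} :=
        hO.inter (isOpen_lt ((EuclideanSpace.proj (0 : Fin 4)).continuous) continuous_const)
      have hF₂d : DifferentiableAt ℝ (F₂ h₀) u :=
        ((hF₂c u ⟨huO, hu0'⟩).contDiffAt (hU.mem_nhds ⟨huO, hu0'⟩)).differentiableAt (by simp)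
      obtain ⟨hv, hd⟩ := gluedProfile_neg_side (F₁ := F₁ h₀) hδ hK hu0' hF₂d hpos' hle hder hΦd
      exact mul_ne_zero (mul_ne_zero hv.ne' hd.ne') (hvol h₀ u huO)
    · have hu0' : 0 < u 0 := by rw [hu0]; exact hpos
      obtain ⟨hpos', hle, hder, -⟩ := hF₁p u huO hu0'
      have hU : IsOpen {u : EuclideanSpace ℝ (Fin 4) | sliceTail u ∈ (extChartAt (𝓡 3) h₀).target ∧ 0 < u 0} :=
        hO.inter (isOpen_lt continuous_const ((EuclideanSpace.proj (0 : Fin 4)).continuous))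
      have hF₁d : DifferentiableAt ℝ (F₁ h₀) u :=
        ((hF₁c u ⟨huO, hu0'⟩).contDiffAt (hU.mem_nhds ⟨huO, hu0'⟩)).differentiableAt (by simp)
      obtain ⟨hv, hd⟩ := gluedProfile_pos_side (F₂ := F₂ h₀) hδ hK hu0' hF₁d hpos' hle hder hΦd
      exact mul_ne_zero (mul_ne_zero hv.ne' hd.ne) (hvol h₀ u huO)

end SeamGluePrimitive


/-! ### The second piece re-indexed by the gluing diffeomorphism; kernels, conformal factor, sign

For the Baykur gluing `X = W₁ ∪_ψ W₂` the boundary datum of `W₂` is re-indexed so that its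
carrier is literally `H = b₁.carrier` (inclusion `incl₂ ∘ ψ`).  The plane-field clause of the
Kähler decomposition makes the kernels of the two boundary contact forms `β₁ = incl₁^*λ₁` and
`β₂' = (incl₂ ∘ ψ)^*λ₂` on `H` coincide, whence a continuous nowhere-zero conformal factor
`β₂' = g β₁`, its (locally constant) sign `ε`, a bound `G ≥ |g|`, and a locally constant
extension `ε₂` of `ε` to `W₂` (every component of `W₂` has connected non-empty boundary). -/

section ConformalSign

variable {W₁ : Type} [TopologicalSpace W₁] [ChartedSpace (EuclideanHalfSpace 4) W₁]
  [IsManifold (𝓡∂ 4) ∞ W₁] [CompactSpace W₁] [T2Space W₁]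
  {W₂ : Type} [TopologicalSpace W₂] [ChartedSpace (EuclideanHalfSpace 4) W₂]
  [IsManifold (𝓡∂ 4) ∞ W₂] [CompactSpace W₂] [T2Space W₂]

/-- **Re-indexing a boundary datum** along a diffeomorphism onto its carrier: carrier `H`,
inclusion `incl ∘ ψ`. [folklore] -/
def reindexBoundaryData (b : BoundaryData (𝓡∂ 4) W₂ (𝓡 3)) {H : Type} [TopologicalSpace H]
    [ChartedSpace (EuclideanSpace ℝ (Fin 3)) H] [IsManifold (𝓡 3) ∞ H]
    (ψ : H ≃ₘ⟮𝓡 3, 𝓡 3⟯ b.carrier) : BoundaryData (𝓡∂ 4) W₂ (𝓡 3) where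
  carrier := H
  incl := b.incl ∘ ψ
  isSmoothEmbedding := b.isSmoothEmbedding.comp_diffeomorph ψ
  range_incl := by
    rw [← b.range_incl]
    exact (EquivLike.surjective ψ).range_comp b.incl

omit [IsManifold (𝓡∂ 4) ∞ W₂] [CompactSpace W₂] [T2Space W₂] in
/-- The inclusion of the re-indexed datum (definitional). [folklore] -/
theorem reindexBoundaryData_incl (b : BoundaryData (𝓡∂ 4) W₂ (𝓡 3)) {H : Type} [TopologicalSpace H]
    [ChartedSpace (EuclideanSpace ℝ (Fin 3)) H] [IsManifold (𝓡 3) ∞ H]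
    (ψ : H ≃ₘ⟮𝓡 3, 𝓡 3⟯ b.carrier) (x : H) : (reindexBoundaryData b ψ).incl x = b.incl (ψ x) :=
  rfl

omit [T2Space W₁] in
/-- The boundary contact form on a single vector is the contact form on its image under the
differential of the inclusion. [folklore] -/
theorem SteinStructure.boundaryContactForm_apply_one (S : SteinStructure W₁)
    (b : BoundaryData (𝓡∂ 4) W₁ (𝓡 3)) (x : b.carrier) (v : EuclideanSpace ℝ (Fin 3)) :
    S.boundaryContactForm b x ![v] = S.contactForm (b.incl x) (mfderiv (𝓡 3) (𝓡∂ 4) b.incl x v) := by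
  rw [SteinStructure.boundaryContactForm, MForm.pullback_apply]
  set φ : (EuclideanSpace ℝ (Fin 4)) [⋀^Fin 1]→L[ℝ] ℝ := (-dComplex S.J S.φ) (b.incl x) with hφ
  exact (form_one_apply_eq φ _).trans rfl

omit [T2Space W₁] in
/-- **The kernel of the boundary contact form is the boundary plane field.** [folklore] -/
theorem SteinStructure.boundaryContactForm_eq_zero_iff (S : SteinStructure W₁)
    (b : BoundaryData (𝓡∂ 4) W₁ (𝓡 3)) (x : b.carrier) (v : EuclideanSpace ℝ (Fin 3)) :
    S.boundaryContactForm b x ![v] = 0 ↔ v ∈ boundaryPlaneField S.J b x := by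
  rw [S.boundaryContactForm_apply_one, mem_boundaryPlaneField_iff,
    S.contactPlane_eq_boundaryTangentSpace_inf_ker (b.incl_mem_boundary x)]
  exact ⟨fun h => ⟨mfderiv_apply_mem_boundaryTangentSpace b.incl (b.incl_mem_boundary x) v, h⟩,
    fun h => h.2⟩

omit [T2Space W₁] [T2Space W₂] in
/-- **The two boundary contact forms on `H` have the same kernels** under the plane-field clause
of the Kähler decomposition. [cite: Baykur2006, Thm. 5.1] -/
theorem boundaryContactForm_eq_zero_iff_of_plane (S₁ : SteinStructure W₁) (S₂ : SteinStructure W₂)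
    (b₁ : BoundaryData (𝓡∂ 4) W₁ (𝓡 3)) (b₂ : BoundaryData (𝓡∂ 4) W₂ (𝓡 3))
    (ψ : b₁.carrier ≃ₘ⟮𝓡 3, 𝓡 3⟯ b₂.carrier)
    (hplane : ∀ z, Submodule.map (mfderiv (𝓡 3) (𝓡∂ 4) (b₂.incl ∘ ψ) z).toLinearMap
      (boundaryPlaneField S₁.J b₁ z) = contactPlane S₂.J (b₂.incl (ψ z)))
    (x : b₁.carrier) (v : EuclideanSpace ℝ (Fin 3)) :
    S₁.boundaryContactForm b₁ x ![v] = 0 ↔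
      S₂.boundaryContactForm (reindexBoundaryData b₂ ψ) x ![v] = 0 := by
  rw [S₁.boundaryContactForm_eq_zero_iff, S₂.boundaryContactForm_eq_zero_iff,
    mem_boundaryPlaneField_iff]
  show v ∈ boundaryPlaneField S₁.J b₁ x ↔
    mfderiv (𝓡 3) (𝓡∂ 4) (b₂.incl ∘ ψ) x v ∈ contactPlane S₂.J (b₂.incl (ψ x))
  rw [← hplane x]
  constructor
  · exact fun h => Submodule.mem_map_of_mem h
  · rintro ⟨v', hv', hvv'⟩
    have hinj : Injective (mfderiv (𝓡 3) (𝓡∂ 4) (b₂.incl ∘ ψ) x) :=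
      Manifold.IsImmersionAt.mfderiv_injective
        ((reindexBoundaryData b₂ ψ).isSmoothEmbedding.isImmersion.isImmersionAt x) (by simp)
    rw [← hinj hvv']
    exact hv'

omit [T2Space W₁] in
/-- The carrier of a boundary datum of a compact manifold is compact. [folklore] -/
theorem BoundaryData.compactSpace_carrier (b : BoundaryData (𝓡∂ 4) W₁ (𝓡 3)) : CompactSpace b.carrier := by
  refine ⟨?_⟩
  rw [b.isSmoothEmbedding.isEmbedding.isInducing.isCompact_iff, Set.image_univ, b.range_incl]
  exact (ModelWithCorners.isClosed_boundary (I := 𝓡∂ 4) (M := W₁) (n := ∞) (by simp)).isCompact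

/-- **The conformal factor and its sign.**  Under the plane-field clause there are a continuous
nowhere-zero `g : H → ℝ` with `β₂' = g β₁`, a smooth `ε : H → ℝ` with values `±1` and
`ε g > 0`, and a bound `G` with `ε g ≤ G`. [cite: Baykur2006, Thm. 5.1] -/
theorem exists_conformal_sign (S₁ : SteinStructure W₁) (S₂ : SteinStructure W₂)
    (b₁ : BoundaryData (𝓡∂ 4) W₁ (𝓡 3)) (b₂ : BoundaryData (𝓡∂ 4) W₂ (𝓡 3))
    (ψ : b₁.carrier ≃ₘ⟮𝓡 3, 𝓡 3⟯ b₂.carrier)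
    (hplane : ∀ z, Submodule.map (mfderiv (𝓡 3) (𝓡∂ 4) (b₂.incl ∘ ψ) z).toLinearMap
      (boundaryPlaneField S₁.J b₁ z) = contactPlane S₂.J (b₂.incl (ψ z))) :
    ∃ (g ε : b₁.carrier → ℝ) (G : ℝ), Continuous g ∧ (∀ x, g x ≠ 0) ∧
      (∀ (x : b₁.carrier) (w : Fin 1 → EuclideanSpace ℝ (Fin 3)),
        S₂.boundaryContactForm (reindexBoundaryData b₂ ψ) x w = g x * S₁.boundaryContactForm b₁ x w) ∧
      ContMDiff (𝓡 3) 𝓘(ℝ) ∞ ε ∧ (∀ x, ε x = 1 ∨ ε x = -1) ∧ (∀ x, 0 < ε x * g x) ∧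
      (∀ x, 0 < g x ↔ ε x = 1) ∧ 0 ≤ G ∧ ∀ x, ε x * g x ≤ G := by
  haveI : CompactSpace b₁.carrier := BoundaryData.compactSpace_carrier b₁
  obtain ⟨g, hgc, hg0, hg, -⟩ := exists_conformalFactor_of_ker_eq
    (S₁.isSmoothForm_boundaryContactForm b₁) (S₂.isSmoothForm_boundaryContactForm (reindexBoundaryData b₂ ψ))
    (fun x v => boundaryContactForm_eq_zero_iff_of_plane S₁ S₂ b₁ b₂ ψ hplane x v)
    (S₁.exists_boundaryContactForm_ne_zero b₁)
  set ε : b₁.carrier → ℝ := fun x => if 0 < g x then 1 else -1 with hε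
  have hεg : ∀ x, 0 < ε x * g x := fun x => by
    by_cases h : 0 < g x
    · simp [hε, h]
    · have : g x < 0 := lt_of_le_of_ne (not_lt.1 h) (hg0 x)
      simp [hε, h]; linarith
  -- `ε` is locally constant, hence smooth
  have hεs : ContMDiff (𝓡 3) 𝓘(ℝ) ∞ ε := fun x => by
    by_cases h : 0 < g x
    · have hev : ε =ᶠ[𝓝 x] fun _ => (1 : ℝ) := by
        filter_upwards [(isOpen_lt continuous_const hgc).mem_nhds h] with y hy
        simp [hε, hy]
      exact contMDiffAt_const.congr_of_eventuallyEq hev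
    · have h' : g x < 0 := lt_of_le_of_ne (not_lt.1 h) (hg0 x)
      have hev : ε =ᶠ[𝓝 x] fun _ => (-1 : ℝ) := by
        filter_upwards [(isOpen_lt hgc continuous_const).mem_nhds h'] with y hy
        have : ¬ 0 < g y := not_lt.2 hy.le
        simp [hε, this]
      exact contMDiffAt_const.congr_of_eventuallyEq hev
  -- the bound
  have hcont : Continuous fun x => ε x * g x := by
    have : (fun x => ε x * g x) = fun x => |g x| := by
      funext x
      by_cases h : 0 < g x
      · simp [hε, h, abs_of_pos h]
      · have h' : g x < 0 := lt_of_le_of_ne (not_lt.1 h) (hg0 x)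
        simp [hε, h, abs_of_neg h']
    rw [this]; exact continuous_abs.comp hgc
  obtain ⟨G, hG⟩ : ∃ G : ℝ, ∀ x, ε x * g x ≤ G := by
    rcases isEmpty_or_nonempty b₁.carrier with hH | hH
    · exact ⟨0, fun x => (IsEmpty.false x).elim⟩
    · obtain ⟨x₀, -, hx₀⟩ := isCompact_univ.exists_isMaxOn univ_nonempty hcont.continuousOn
      exact ⟨ε x₀ * g x₀, fun x => hx₀ (mem_univ x)⟩
  refine ⟨g, ε, max G 0, hgc, hg0, hg, hεs, fun x => ?_, hεg, fun x => ?_, le_max_right _ _,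
    fun x => (hG x).trans (le_max_left _ _)⟩
  · by_cases h : 0 < g x
    · simp [hε, h]
    · simp [hε, h]
  · by_cases h : 0 < g x
    · simp [hε, h]
    · simp only [hε, h, if_false]
      norm_num

/-- **The sign extended to the second piece**: `ε₂ y = 1` iff some boundary point of the
component of `y` has positive conformal factor. [folklore] -/
def signExtension (b₂ : BoundaryData (𝓡∂ 4) W₂ (𝓡 3)) {H : Type} (ι : H → b₂.carrier) (g : H → ℝ)
    (y : W₂) : ℝ :=
  by classical exact if ∃ x, b₂.incl (ι x) ∈ connectedComponent y ∧ 0 < g x then 1 else -1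

omit [IsManifold (𝓡∂ 4) ∞ W₂] [CompactSpace W₂] [T2Space W₂] in
/-- The extended sign only depends on the connected component. [folklore] -/
theorem signExtension_eq_of_mem_connectedComponent (b₂ : BoundaryData (𝓡∂ 4) W₂ (𝓡 3)) {H : Type}
    (ι : H → b₂.carrier) (g : H → ℝ) {y y' : W₂} (h : y' ∈ connectedComponent y) :
    signExtension b₂ ι g y' = signExtension b₂ ι g y := by
  unfold signExtension
  rw [connectedComponent_eq h]

omit [IsManifold (𝓡∂ 4) ∞ W₂] [CompactSpace W₂] [T2Space W₂] in
/-- The extended sign is locally constant, hence smooth. [folklore] -/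
theorem contMDiff_signExtension (b₂ : BoundaryData (𝓡∂ 4) W₂ (𝓡 3)) {H : Type} (ι : H → b₂.carrier)
    (g : H → ℝ) : ContMDiff (𝓡∂ 4) 𝓘(ℝ) ∞ (signExtension b₂ ι g) := fun y => by
  haveI : LocallyConnectedSpace W₂ := ChartedSpace.locallyConnectedSpace (EuclideanHalfSpace 4) W₂
  have hev : signExtension b₂ ι g =ᶠ[𝓝 y] fun _ => signExtension b₂ ι g y := by
    filter_upwards [isOpen_connectedComponent.mem_nhds mem_connectedComponent] with y' hy'
    exact signExtension_eq_of_mem_connectedComponent b₂ ι g hy'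
  exact contMDiffAt_const.congr_of_eventuallyEq hev

omit [IsManifold (𝓡∂ 4) ∞ W₂] [CompactSpace W₂] [T2Space W₂] in
/-- The extended sign takes the values `±1`. [folklore] -/
theorem signExtension_eq_or (b₂ : BoundaryData (𝓡∂ 4) W₂ (𝓡 3)) {H : Type} (ι : H → b₂.carrier)
    (g : H → ℝ) (y : W₂) : signExtension b₂ ι g y = 1 ∨ signExtension b₂ ι g y = -1 := by
  unfold signExtension
  split_ifs <;> simp

/-- **The extended sign restricts to the sign on the boundary**: along `incl₂ ∘ ψ` the extended
sign is the sign of `g` — every component of the Stein domain `W₂` meets the boundary in a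
connected set, on which the continuous nowhere-zero `g` has constant sign.
[cite: Etnyre2004, Thm. 4.1] -/
theorem signExtension_incl (S₂ : SteinStructure W₂) (b₂ : BoundaryData (𝓡∂ 4) W₂ (𝓡 3))
    {H : Type} [TopologicalSpace H] [ChartedSpace (EuclideanSpace ℝ (Fin 3)) H] [IsManifold (𝓡 3) ∞ H]
    (ψ : H ≃ₘ⟮𝓡 3, 𝓡 3⟯ b₂.carrier) {g : H → ℝ} (hgc : Continuous g) (hg0 : ∀ x, g x ≠ 0) (x₀ : H) :
    signExtension b₂ ψ g (b₂.incl (ψ x₀)) = if 0 < g x₀ then 1 else -1 := by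
  classical
  set e : H → W₂ := b₂.incl ∘ ψ with he
  have hemb : Topology.IsEmbedding e := (reindexBoundaryData b₂ ψ).isSmoothEmbedding.isEmbedding
  have hrange : range e = (𝓡∂ 4).boundary W₂ := (reindexBoundaryData b₂ ψ).range_incl
  -- the boundary of the component of `e x₀`, pulled back to `H`, is preconnected
  set C : Set W₂ := connectedComponent (e x₀) with hC
  have hpre : IsPreconnected (e ⁻¹' C) := by
    have h1 : IsPreconnected ((𝓡∂ 4).boundary W₂ ∩ C) := by
      have := (S₂.isPreconnected_boundary_inter_compOpens (ConnectedComponents.mk (e x₀))).1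
      rwa [coe_compOpens_mk] at this
    have h2 : (𝓡∂ 4).boundary W₂ ∩ C = e '' (e ⁻¹' C) := by
      rw [image_preimage_eq_inter_range, hrange, inter_comm]
    rw [h2] at h1
    exact (hemb.isInducing.isPreconnected_image).1 h1
  -- `g` has constant sign on it
  have hx₀C : x₀ ∈ e ⁻¹' C := mem_connectedComponent
  have key : ∀ x ∈ e ⁻¹' C, (0 < g x ↔ 0 < g x₀) := by
    intro x hx
    by_contra hne
    have hopp : (0 < g x ∧ g x₀ < 0) ∨ (g x < 0 ∧ 0 < g x₀) := by
      rcases lt_or_gt_of_ne (hg0 x) with h1 | h1 <;> rcases lt_or_gt_of_ne (hg0 x₀) with h2 | h2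
      · exact absurd (iff_of_false (not_lt.2 h1.le) (not_lt.2 h2.le)) hne
      · exact Or.inr ⟨h1, h2⟩
      · exact Or.inl ⟨h1, h2⟩
      · exact absurd (iff_of_true h1 h2) hne
    rcases hopp with ⟨h1, h2⟩ | ⟨h1, h2⟩
    · obtain ⟨z, -, hz⟩ := hpre.intermediate_value hx₀C hx hgc.continuousOn ⟨h2.le, h1.le⟩
      exact hg0 z hz
    · obtain ⟨z, -, hz⟩ := hpre.intermediate_value hx hx₀C hgc.continuousOn ⟨h1.le, h2.le⟩
      exact hg0 z hz
  unfold signExtension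
  by_cases h0 : 0 < g x₀
  · rw [if_pos h0, if_pos]
    exact ⟨x₀, mem_connectedComponent, h0⟩
  · rw [if_neg h0, if_neg]
    rintro ⟨x, hx, hgx⟩
    exact h0 ((key x hx).1 hgx)

end ConformalSign


/-! ### The Kähler form on the interior of a Stein piece, rescaled by a locally constant sign -/

section InteriorForms

variable {W : Type*} [TopologicalSpace W] [ChartedSpace (EuclideanHalfSpace 4) W]
  [IsManifold (𝓡∂ 4) ∞ W] [CompactSpace W] [T2Space W] (S : SteinStructure W)

/-- The Liouville form restricted to the interior `W - ∂W`. [folklore] -/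
def SteinStructure.interiorLiouville : MForm 𝓘(ℝ, EuclideanSpace ℝ (Fin 4)) (InteriorManifold (𝓡∂ 4) W) ℝ 1 :=
  (-dComplex S.J S.φ).pullback 𝓘(ℝ, EuclideanSpace ℝ (Fin 4)) InteriorManifold.val

/-- **The rescaled Kähler form on the interior**: `d((ρ ∘ val) · λ|_{W - ∂W})` for a function
`ρ : W → ℝ` (locally constant in the application). [folklore] -/
def SteinStructure.interiorKahler (ρ : W → ℝ) : MForm 𝓘(ℝ, EuclideanSpace ℝ (Fin 4)) (InteriorManifold (𝓡∂ 4) W) ℝ 2 :=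
  mextDeriv ((fun a : InteriorManifold (𝓡∂ 4) W => ρ a.val) • S.interiorLiouville)

/-- The restricted Liouville form is smooth. [folklore] -/
theorem SteinStructure.isSmoothForm_interiorLiouville : IsSmoothForm S.interiorLiouville := fun _ =>
  MForm.SmoothAt.pullback (Eventually.of_forall fun a' => InteriorManifold.contMDiff_val a')
    (S.isSmoothForm_liouvilleForm _)

omit [CompactSpace W] [T2Space W] in
/-- The differential of `val : W - ∂W → W` is injective. [folklore] -/
theorem InteriorManifold.injective_mfderiv_val (a : InteriorManifold (𝓡∂ 4) W) :
    Injective (mfderiv 𝓘(ℝ, EuclideanSpace ℝ (Fin 4)) (𝓡∂ 4) InteriorManifold.val a) := by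
  set g : W → InteriorManifold (𝓡∂ 4) W := InteriorManifold.ofPt a with hg
  have himm : Manifold.IsImmersionAtOfComplement PUnit.{1} (𝓡∂ 4) 𝓘(ℝ, EuclideanSpace ℝ (Fin 4)) ∞ g a.val :=
    InteriorManifold.isImmersionAtOfComplement_of_val_eq (g := g)
      (fun m hm => InteriorManifold.ofPt_val_of_isInteriorPoint a hm) a
  have hgs : ContMDiffAt (𝓡∂ 4) 𝓘(ℝ, EuclideanSpace ℝ (Fin 4)) ∞ g a.val := himm.contMDiffAt
  have hcomp : g ∘ InteriorManifold.val = id := by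
    funext a'
    show InteriorManifold.ofPt a a'.val = a'
    rw [InteriorManifold.ofPt_of_isInteriorPoint a a'.property]
  have hid : (mfderiv (𝓡∂ 4) 𝓘(ℝ, EuclideanSpace ℝ (Fin 4)) g a.val).comp
      (mfderiv 𝓘(ℝ, EuclideanSpace ℝ (Fin 4)) (𝓡∂ 4) InteriorManifold.val a) =
      ContinuousLinearMap.id ℝ _ := by
    rw [← mfderiv_comp a (hgs.mdifferentiableAt (by simp))
      ((InteriorManifold.contMDiff_val a).mdifferentiableAt (by simp)), hcomp, mfderiv_id]
  intro v w hvw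
  have h := congrArg (mfderiv (𝓡∂ 4) 𝓘(ℝ, EuclideanSpace ℝ (Fin 4)) g a.val) hvw
  have hv := congrArg (fun T : TangentSpace 𝓘(ℝ, EuclideanSpace ℝ (Fin 4)) a →L[ℝ]
    TangentSpace 𝓘(ℝ, EuclideanSpace ℝ (Fin 4)) a => T v) hid
  have hw := congrArg (fun T : TangentSpace 𝓘(ℝ, EuclideanSpace ℝ (Fin 4)) a →L[ℝ]
    TangentSpace 𝓘(ℝ, EuclideanSpace ℝ (Fin 4)) a => T w) hid
  have h' : ((mfderiv (𝓡∂ 4) 𝓘(ℝ, EuclideanSpace ℝ (Fin 4)) g a.val).comp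
      (mfderiv 𝓘(ℝ, EuclideanSpace ℝ (Fin 4)) (𝓡∂ 4) InteriorManifold.val a)) v =
    ((mfderiv (𝓡∂ 4) 𝓘(ℝ, EuclideanSpace ℝ (Fin 4)) g a.val).comp
      (mfderiv 𝓘(ℝ, EuclideanSpace ℝ (Fin 4)) (𝓡∂ 4) InteriorManifold.val a)) w := h
  exact hv.symm.trans (h'.trans hw)

omit [CompactSpace W] [T2Space W] in
/-- The differential of `val : W - ∂W → W` is surjective. [folklore] -/
theorem InteriorManifold.surjective_mfderiv_val (a : InteriorManifold (𝓡∂ 4) W) :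
    Surjective (mfderiv 𝓘(ℝ, EuclideanSpace ℝ (Fin 4)) (𝓡∂ 4) InteriorManifold.val a) := by
  have hinj := InteriorManifold.injective_mfderiv_val a
  have h : Injective ((mfderiv 𝓘(ℝ, EuclideanSpace ℝ (Fin 4)) (𝓡∂ 4) InteriorManifold.val a :
      EuclideanSpace ℝ (Fin 4) →L[ℝ] EuclideanSpace ℝ (Fin 4)).toLinearMap) := hinj
  exact LinearMap.injective_iff_surjective.1 h

/-- **The rescaled Kähler form on the interior is smooth, closed and non-degenerate, and equals
`ρ(a) · val^*ω` at `a`**, for a smooth, locally constant, nowhere-zero `ρ`. [folklore] -/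
theorem SteinStructure.interiorKahler_package {ρ : W → ℝ} (hρs : ContMDiff (𝓡∂ 4) 𝓘(ℝ) ∞ ρ)
    (hρlc : ∀ y, ∀ᶠ y' in 𝓝 y, ρ y' = ρ y) (hρ0 : ∀ y, ρ y ≠ 0) :
    IsSmoothForm (S.interiorKahler ρ) ∧ (∀ a, mextDeriv (S.interiorKahler ρ) a = 0) ∧
    (∀ (a : InteriorManifold (𝓡∂ 4) W) (v : EuclideanSpace ℝ (Fin 4)), v ≠ 0 →
      ∃ w : EuclideanSpace ℝ (Fin 4), S.interiorKahler ρ a ![v, w] ≠ 0) ∧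
    ∀ a, S.interiorKahler ρ a = ρ a.val •
      ((mextDeriv (-dComplex S.J S.φ)).pullback 𝓘(ℝ, EuclideanSpace ℝ (Fin 4)) InteriorManifold.val) a := by
  set μ : MForm 𝓘(ℝ, EuclideanSpace ℝ (Fin 4)) (InteriorManifold (𝓡∂ 4) W) ℝ 1 :=
    (fun a : InteriorManifold (𝓡∂ 4) W => ρ a.val) • S.interiorLiouville with hμ
  have hρs' : ContMDiff 𝓘(ℝ, EuclideanSpace ℝ (Fin 4)) 𝓘(ℝ) ∞ fun a : InteriorManifold (𝓡∂ 4) W => ρ a.val :=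
    hρs.comp InteriorManifold.contMDiff_val
  have hμs : IsSmoothForm μ := IsSmoothForm.fun_smul' hρs' S.isSmoothForm_interiorLiouville
  have hτ : S.interiorKahler ρ = mextDeriv μ := rfl
  -- smoothness and closedness
  have h1 : IsSmoothForm (S.interiorKahler ρ) := by
    rw [hτ]; exact isSmoothForm_mextDeriv (inChart_mextDeriv_holds _ _ _) hμs
  have h2 : ∀ a, mextDeriv (S.interiorKahler ρ) a = 0 := fun a => by
    rw [hτ]; exact mextDeriv_mextDeriv_of_smoothAt (Eventually.of_forall fun a' => hμs a')
  -- the formula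
  have h4 : ∀ a, S.interiorKahler ρ a = ρ a.val •
      ((mextDeriv (-dComplex S.J S.φ)).pullback 𝓘(ℝ, EuclideanSpace ℝ (Fin 4)) InteriorManifold.val) a := by
    intro a
    have hev : ∀ᶠ a' in 𝓝 a, μ a' = ((ρ a.val) • S.interiorLiouville) a' := by
      have hc : ContinuousAt (InteriorManifold.val : InteriorManifold (𝓡∂ 4) W → W) a :=
        InteriorManifold.continuous_val.continuousAt
      filter_upwards [hc.eventually (hρlc a.val)] with a' ha'
      show ρ a'.val • S.interiorLiouville a' = ρ a.val • S.interiorLiouville a'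
      rw [show ρ a'.val = ρ a.val from ha']
    rw [hτ, Literature.Geometry.Kaehler.mextDeriv_congr_of_eventuallyEq hev, mextDeriv_smul]
    show ρ a.val • mextDeriv S.interiorLiouville a = _
    congr 1
    exact mextDeriv_pullback_apply (Eventually.of_forall fun a' => InteriorManifold.contMDiff_val a')
      (S.isSmoothForm_liouvilleForm _)
  refine ⟨h1, h2, fun a v hv => ?_, h4⟩
  -- non-degeneracy
  set D := mfderiv 𝓘(ℝ, EuclideanSpace ℝ (Fin 4)) (𝓡∂ 4) InteriorManifold.val a with hD
  have hDv : D v ≠ 0 := fun h => hv (InteriorManifold.injective_mfderiv_val a (h.trans (map_zero D).symm))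
  have hnd := S.isLiouvilleDomain.nondegenerate a.val (D v)
  have hex : ∃ w' : EuclideanSpace ℝ (Fin 4), mextDeriv (-dComplex S.J S.φ) a.val ![D v, w'] ≠ 0 := by
    by_contra h
    push Not at h
    exact hDv (hnd h)
  obtain ⟨w', hw'⟩ := hex
  obtain ⟨w, rfl⟩ := InteriorManifold.surjective_mfderiv_val a w'
  refine ⟨w, ?_⟩
  rw [h4 a]
  show ρ a.val * (mextDeriv (-dComplex S.J S.φ)) a.val (fun i => D (![v, w] i)) ≠ 0
  refine mul_ne_zero (hρ0 _) ?_
  have hvec : (fun i => D (![v, w] i)) = ![D v, D w] := by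
    funext i
    fin_cases i <;> rfl
  rw [hvec]
  exact hw'

end InteriorForms


/-! ### The Stein glue datum and the compatibility of the push-forwards on the overlaps -/

section Stitch

variable {W₁ : Type} [TopologicalSpace W₁] [ChartedSpace (EuclideanHalfSpace 4) W₁]
  [IsManifold (𝓡∂ 4) ∞ W₁] [CompactSpace W₁] [T2Space W₁] (S₁ : SteinStructure W₁)
  {c₀ c₁ : ℝ} {hc : c₀ < c₁} {hc₁ : c₁ < sSup (range S₁.φ)}
  {hreg : ∀ x, c₀ ≤ S₁.φ x → S₁.dφ x ≠ 0} {D₁ : FlowoutInput 3 W₁}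
  (hD₁ : D₁ = S₁.liouvilleFlowout hc hc₁ hreg) (Γ₁ : D₁.Cover)
  (b₁ : BoundaryData (𝓡∂ 4) W₁ (𝓡 3)) [Nonempty b₁.carrier]
  {W₂ : Type} [TopologicalSpace W₂] [ChartedSpace (EuclideanHalfSpace 4) W₂]
  [IsManifold (𝓡∂ 4) ∞ W₂] [CompactSpace W₂] [T2Space W₂] (S₂ : SteinStructure W₂)
  {c₀' c₁' : ℝ} {hc' : c₀' < c₁'} {hc₁' : c₁' < sSup (range S₂.φ)}
  {hreg' : ∀ x, c₀' ≤ S₂.φ x → S₂.dφ x ≠ 0} {D₂ : FlowoutInput 3 W₂}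
  (hD₂ : D₂ = S₂.liouvilleFlowout hc' hc₁' hreg') (Γ₂ : D₂.Cover)
  (b₂ : BoundaryData (𝓡∂ 4) W₂ (𝓡 3)) (ψ : b₁.carrier ≃ₘ⟮𝓡 3, 𝓡 3⟯ b₂.carrier)

/-- The re-indexed second datum has the (non-empty) carrier `H`. [folklore] -/
instance nonempty_reindex_carrier : Nonempty (reindexBoundaryData b₂ ψ).carrier :=
  ‹Nonempty b₁.carrier›

/-- **The Stein glue datum**: the Liouville open collars of the two pieces (the second re-indexed
by `ψ`), glued along the identity of `H`. [cite: Baykur2006, proof of Thm. 6.1] -/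
def steinGlueData : BoundaryGlueData b₁ (reindexBoundaryData b₂ ψ) where
  CM := Γ₁.openCollar b₁
  CN := Γ₂.openCollar (reindexBoundaryData b₂ ψ)
  φ := Diffeomorph.refl (𝓡 3) b₁.carrier ∞

omit [CompactSpace W₁] [CompactSpace W₂] in
/-- The collar of the first piece (definitional). [folklore] -/
theorem steinGlueData_CM : (steinGlueData Γ₁ b₁ Γ₂ b₂ ψ).CM = Γ₁.openCollar b₁ := rfl

omit [CompactSpace W₁] [CompactSpace W₂] in
/-- The collar of the second piece (definitional). [folklore] -/
theorem steinGlueData_CN : (steinGlueData Γ₁ b₁ Γ₂ b₂ ψ).CN = Γ₂.openCollar (reindexBoundaryData b₂ ψ) := rfl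

omit [CompactSpace W₁] [CompactSpace W₂] in
/-- The gluing diffeomorphism is the identity (definitional). [folklore] -/
theorem steinGlueData_φ (x : b₁.carrier) : (steinGlueData Γ₁ b₁ Γ₂ b₂ ψ).φ x = x := rfl

omit [CompactSpace W₂] in
/-- **Compatibility on the first overlap**: on seam points with parameter `> 2δ`, where the
seam primitive is the collar form `α₁ = CM^*λ₁`, the push-forward of `dΛ` along the seam
embedding is the push-forward of the interior Kähler form `val^*ω₁` along `ι₁`.
[cite: Baykur2006, proof of Thm. 6.1] -/
theorem stitch_compat_M [Nonempty (InteriorManifold (𝓡∂ 4) W₁)] {δ : ℝ} (hδ : 0 < δ)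
    {Λ : MForm ((𝓡 3).prod 𝓘(ℝ, ℝ)) (b₁.carrier × ℝ) ℝ 1}
    (hΛ : ∀ q : b₁.carrier × ℝ, 2 * δ < q.2 → Λ q = S₁.collarLiouvilleForm Γ₁ b₁ q)
    (p : b₁.carrier × ℝ) (hp : 2 * δ < p.2) :
    ((mextDeriv Λ).pullback (𝓡 4) (Function.invFun (seamEmb (steinGlueData Γ₁ b₁ Γ₂ b₂ ψ))))
        (seamEmb (steinGlueData Γ₁ b₁ Γ₂ b₂ ψ) p) =
      ((S₁.interiorKahler fun _ => 1).pullback (𝓡 4)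
        (Function.invFun (intEmbM (steinGlueData Γ₁ b₁ Γ₂ b₂ ψ)))) (seamEmb (steinGlueData Γ₁ b₁ Γ₂ b₂ ψ) p) := by
  have hp0 : 0 < p.2 := by linarith
  -- notation-free abbreviations
  have hinjσ := injective_seamEmb (steinGlueData Γ₁ b₁ Γ₂ b₂ ψ)
  have hopenσ := isOpenMap_seamEmb (steinGlueData Γ₁ b₁ Γ₂ b₂ ψ)
  have hinvσ := contMDiffAt_invFun_seamEmb (steinGlueData Γ₁ b₁ Γ₂ b₂ ψ)
  have hinjι := injective_intEmbM (steinGlueData Γ₁ b₁ Γ₂ b₂ ψ)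
  have hinvι := contMDiffAt_invFun_intEmbM (steinGlueData Γ₁ b₁ Γ₂ b₂ ψ)
  -- Step 1: `dΛ = μ^*ω₁` at `p`, `μ = uncurry CM`
  have hμ : ∀ q : b₁.carrier × ℝ, 0 < q.2 → ContMDiffAt ((𝓡 3).prod 𝓘(ℝ, ℝ)) (𝓡∂ 4) ∞
      (uncurry (Γ₁.openCollar b₁).toFun) q := fun q hq =>
    SteinStructure.contMDiffAt_uncurry_openCollar Γ₁ b₁ q.1 hq
  have h1 : mextDeriv Λ p = ((mextDeriv (-dComplex S₁.J S₁.φ)).pullback ((𝓡 3).prod 𝓘(ℝ, ℝ))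
      (uncurry (Γ₁.openCollar b₁).toFun)) p := by
    have hev : ∀ᶠ q in 𝓝 p, Λ q = S₁.collarLiouvilleForm Γ₁ b₁ q := by
      filter_upwards [(isOpen_lt continuous_const continuous_snd).mem_nhds hp] with q hq
      exact hΛ q hq
    rw [Literature.Geometry.Kaehler.mextDeriv_congr_of_eventuallyEq hev]
    refine mextDeriv_pullback_apply ?_ (S₁.isSmoothForm_liouvilleForm _)
    filter_upwards [(isOpen_lt continuous_const continuous_snd).mem_nhds hp0] with q hq
    exact hμ q hq
  -- Step 2: LHS = ω₁ pulled back along `μ ∘ σ⁻¹`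
  have hval : Function.invFun (seamEmb (steinGlueData Γ₁ b₁ Γ₂ b₂ ψ))
      (seamEmb (steinGlueData Γ₁ b₁ Γ₂ b₂ ψ) p) = p := Function.leftInverse_invFun hinjσ p
  have h2 := MForm.pullback_pullback_apply (IA := 𝓡 4) (mextDeriv (-dComplex S₁.J S₁.φ))
    (g := uncurry (Γ₁.openCollar b₁).toFun) (f := Function.invFun (seamEmb (steinGlueData Γ₁ b₁ Γ₂ b₂ ψ)))
    (x := seamEmb (steinGlueData Γ₁ b₁ Γ₂ b₂ ψ) p)
    (by rw [hval]; exact (hμ p hp0).mdifferentiableAt (by simp)) ((hinvσ p).mdifferentiableAt (by simp))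
  -- Step 3: RHS = ω₁ pulled back along `val ∘ ι₁⁻¹`
  obtain ⟨-, -, -, h4⟩ := S₁.interiorKahler_package (ρ := fun _ => (1 : ℝ)) contMDiff_const
    (fun y => Eventually.of_forall fun _ => rfl) (fun _ => one_ne_zero)
  have hσι : seamEmb (steinGlueData Γ₁ b₁ Γ₂ b₂ ψ) p =
      intEmbM (steinGlueData Γ₁ b₁ Γ₂ b₂ ψ) ((Γ₁.openCollar b₁).inPt p) :=
    seamEmb_eq_intEmbM (steinGlueData Γ₁ b₁ Γ₂ b₂ ψ) hp0
  have hτ : ∀ a, S₁.interiorKahler (fun _ => 1) a = ((mextDeriv (-dComplex S₁.J S₁.φ)).pullback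
      𝓘(ℝ, EuclideanSpace ℝ (Fin 4)) InteriorManifold.val) a := fun a => by
    rw [h4 a, one_smul]
  have h3 := MForm.pullback_pullback_apply (IA := 𝓡 4) (mextDeriv (-dComplex S₁.J S₁.φ))
    (g := (InteriorManifold.val : InteriorManifold (𝓡∂ 4) W₁ → W₁))
    (f := Function.invFun (intEmbM (steinGlueData Γ₁ b₁ Γ₂ b₂ ψ)))
    (x := seamEmb (steinGlueData Γ₁ b₁ Γ₂ b₂ ψ) p)
    ((InteriorManifold.contMDiff_val _).mdifferentiableAt (by simp))
    (by rw [hσι]; exact (hinvι _).mdifferentiableAt (by simp))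
  -- Step 4: the two maps agree near `σ p`
  have h5 : (uncurry (Γ₁.openCollar b₁).toFun ∘ Function.invFun (seamEmb (steinGlueData Γ₁ b₁ Γ₂ b₂ ψ)))
      =ᶠ[𝓝 (seamEmb (steinGlueData Γ₁ b₁ Γ₂ b₂ ψ) p)]
      ((InteriorManifold.val : InteriorManifold (𝓡∂ 4) W₁ → W₁) ∘
        Function.invFun (intEmbM (steinGlueData Γ₁ b₁ Γ₂ b₂ ψ))) := by
    filter_upwards [(hopenσ _ (isOpen_lt continuous_const continuous_snd)).mem_nhds
      (mem_image_of_mem _ hp0)] with q hq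
    obtain ⟨q, hq0, rfl⟩ := hq
    show uncurry (Γ₁.openCollar b₁).toFun (Function.invFun (seamEmb (steinGlueData Γ₁ b₁ Γ₂ b₂ ψ))
      (seamEmb (steinGlueData Γ₁ b₁ Γ₂ b₂ ψ) q)) = _
    rw [Function.leftInverse_invFun hinjσ q]
    show (Γ₁.openCollar b₁).toFun q.1 q.2 = (Function.invFun (intEmbM (steinGlueData Γ₁ b₁ Γ₂ b₂ ψ))
      (seamEmb (steinGlueData Γ₁ b₁ Γ₂ b₂ ψ) q)).val
    rw [seamEmb_eq_intEmbM (steinGlueData Γ₁ b₁ Γ₂ b₂ ψ) (show 0 < q.2 from hq0),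
      Function.leftInverse_invFun hinjι]
    exact ((Γ₁.openCollar b₁).inPt_val (p := q) hq0).symm
  -- assemble
  have hL : ((mextDeriv Λ).pullback (𝓡 4) (Function.invFun (seamEmb (steinGlueData Γ₁ b₁ Γ₂ b₂ ψ))))
      (seamEmb (steinGlueData Γ₁ b₁ Γ₂ b₂ ψ) p) =
    (((mextDeriv (-dComplex S₁.J S₁.φ)).pullback ((𝓡 3).prod 𝓘(ℝ, ℝ)) (uncurry (Γ₁.openCollar b₁).toFun)).pullback
      (𝓡 4) (Function.invFun (seamEmb (steinGlueData Γ₁ b₁ Γ₂ b₂ ψ)))) (seamEmb (steinGlueData Γ₁ b₁ Γ₂ b₂ ψ) p) := by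
    refine MForm.pullback_congr_form ?_
    rw [hval]; exact h1
  have hR : ((S₁.interiorKahler fun _ => 1).pullback (𝓡 4)
      (Function.invFun (intEmbM (steinGlueData Γ₁ b₁ Γ₂ b₂ ψ)))) (seamEmb (steinGlueData Γ₁ b₁ Γ₂ b₂ ψ) p) =
    ((((mextDeriv (-dComplex S₁.J S₁.φ)).pullback 𝓘(ℝ, EuclideanSpace ℝ (Fin 4)) InteriorManifold.val)).pullback
      (𝓡 4) (Function.invFun (intEmbM (steinGlueData Γ₁ b₁ Γ₂ b₂ ψ)))) (seamEmb (steinGlueData Γ₁ b₁ Γ₂ b₂ ψ) p) :=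
    MForm.pullback_congr_form (hτ _)
  refine hL.trans (h2.trans ?_)
  refine Eq.trans ?_ (hR.trans h3).symm
  exact MForm.pullback_congr_map _ h5


omit [IsManifold (𝓡∂ 4) ∞ W₁] [CompactSpace W₁] [T2Space W₁] [CompactSpace W₂] in
/-- A collar point of the second piece lies in the connected component of its boundary base
point. [folklore] -/
theorem openCollar_mem_connectedComponent (x : b₁.carrier) {s : ℝ} (hs : 0 ≤ s) :
    (Γ₂.openCollar (reindexBoundaryData b₂ ψ)).toFun x s ∈ connectedComponent (b₂.incl (ψ x)) := by
  set C := Γ₂.openCollar (reindexBoundaryData b₂ ψ) with hC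
  have hcont : ContinuousOn (fun t : ℝ => C.toFun x t) (Icc 0 s) := by
    have h := C.continuousOn_toFun
    have hc : Continuous fun t : ℝ => ((x, t) : (reindexBoundaryData b₂ ψ).carrier × ℝ) :=
      continuous_const.prodMk continuous_id
    refine (h.comp hc.continuousOn fun t ht => ⟨mem_univ _, ht.1⟩).congr fun t _ => rfl
  have hpre : IsPreconnected ((fun t : ℝ => C.toFun x t) '' Icc 0 s) := isPreconnected_Icc.image _ hcont
  have h0 : C.toFun x 0 ∈ (fun t : ℝ => C.toFun x t) '' Icc 0 s := ⟨0, ⟨le_rfl, hs⟩, rfl⟩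
  have hsub := hpre.subset_connectedComponent h0
  have hbase : C.toFun x 0 = b₂.incl (ψ x) := C.apply_zero x
  rw [← hbase]
  exact hsub ⟨s, ⟨hs, le_rfl⟩, rfl⟩

omit [CompactSpace W₁] in
/-- **Compatibility on the second overlap**: on seam points with parameter `< -2δ`, where the
seam primitive is the flipped collar form `α₂ = ε · ν^*(CN^*λ₂)`, the push-forward of `dΛ` along
the seam embedding is the push-forward of the rescaled interior Kähler form `ε₂ · val^*ω₂`
along `ι₂`, `ε₂` the component-wise extension of the sign `ε`.
[cite: Baykur2006, proof of Thm. 6.1] -/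
theorem stitch_compat_N [Nonempty (InteriorManifold (𝓡∂ 4) W₂)] {δ : ℝ} (hδ : 0 < δ)
    {g ε : b₁.carrier → ℝ} (hgc : Continuous g) (hg0 : ∀ x, g x ≠ 0)
    (hεc : ContMDiff (𝓡 3) 𝓘(ℝ) ∞ ε) (hε1 : ∀ x, ε x = 1 ∨ ε x = -1) (hεg : ∀ x, 0 < g x ↔ ε x = 1)
    {Λ : MForm ((𝓡 3).prod 𝓘(ℝ, ℝ)) (b₁.carrier × ℝ) ℝ 1}
    (hΛ : ∀ q : b₁.carrier × ℝ, q.2 < -(2 * δ) →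
      Λ q = S₂.flippedCollarForm Γ₂ (reindexBoundaryData b₂ ψ) ε q)
    (p : b₁.carrier × ℝ) (hp : p.2 < -(2 * δ)) :
    ((mextDeriv Λ).pullback (𝓡 4) (Function.invFun (seamEmb (steinGlueData Γ₁ b₁ Γ₂ b₂ ψ))))
        (seamEmb (steinGlueData Γ₁ b₁ Γ₂ b₂ ψ) p) =
      ((S₂.interiorKahler (signExtension b₂ ψ g)).pullback (𝓡 4)
        (Function.invFun (intEmbN (steinGlueData Γ₁ b₁ Γ₂ b₂ ψ)))) (seamEmb (steinGlueData Γ₁ b₁ Γ₂ b₂ ψ) p) := by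
  have hp0 : p.2 < 0 := by linarith
  set C := Γ₂.openCollar (reindexBoundaryData b₂ ψ) with hC
  set ν : b₁.carrier × ℝ → W₂ := uncurry C.toFun ∘ seamFlip with hν
  have hinjσ := injective_seamEmb (steinGlueData Γ₁ b₁ Γ₂ b₂ ψ)
  have hopenσ := isOpenMap_seamEmb (steinGlueData Γ₁ b₁ Γ₂ b₂ ψ)
  have hinvσ := contMDiffAt_invFun_seamEmb (steinGlueData Γ₁ b₁ Γ₂ b₂ ψ)
  have hinjι := injective_intEmbN (steinGlueData Γ₁ b₁ Γ₂ b₂ ψ)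
  have hinvι := contMDiffAt_invFun_intEmbN (steinGlueData Γ₁ b₁ Γ₂ b₂ ψ)
  -- smoothness of `ν` near points with negative parameter
  have hμ : ∀ q : b₁.carrier × ℝ, 0 < q.2 → ContMDiffAt ((𝓡 3).prod 𝓘(ℝ, ℝ)) (𝓡∂ 4) ∞
      (uncurry C.toFun) q := fun q hq =>
    SteinStructure.contMDiffAt_uncurry_openCollar Γ₂ (reindexBoundaryData b₂ ψ) q.1 hq
  have hνs : ∀ q : b₁.carrier × ℝ, q.2 < 0 → ContMDiffAt ((𝓡 3).prod 𝓘(ℝ, ℝ)) (𝓡∂ 4) ∞ ν q :=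
    fun q hq => (hμ (seamFlip q) (by simpa using hq)).comp q (contMDiff_seamFlip q)
  -- `ε` is constant near `p.1`
  have hεopen : IsOpen {x : b₁.carrier | ε x = ε p.1} := by
    rw [isOpen_iff_mem_nhds]
    intro x hx
    have hcx : ContinuousAt ε x := hεc.continuous.continuousAt
    filter_upwards [hcx (Metric.ball_mem_nhds (ε x) one_pos)] with y hy
    have hxy : ε y = ε x := by
      rcases hε1 y with h1 | h1 <;> rcases hε1 x with h2 | h2
      · rw [h1, h2]
      · exfalso
        rw [mem_preimage, Metric.mem_ball, h1, h2, Real.dist_eq] at hy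
        norm_num at hy
      · exfalso
        rw [mem_preimage, Metric.mem_ball, h1, h2, Real.dist_eq] at hy
        norm_num at hy
      · rw [h1, h2]
    exact hxy.trans hx
  -- Step 1: `dΛ = ε(p.1) · ν^*ω₂` at `p`
  have h1 : mextDeriv Λ p = ((ε p.1) • ((mextDeriv (-dComplex S₂.J S₂.φ)).pullback
      ((𝓡 3).prod 𝓘(ℝ, ℝ)) ν)) p := by
    -- `Λ = ε(p.1) · ν^*λ₂` near `p`
    have hev : ∀ᶠ q in 𝓝 p, Λ q = ((ε p.1) • ((-dComplex S₂.J S₂.φ).pullback ((𝓡 3).prod 𝓘(ℝ, ℝ)) ν)) q := by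
      have ho : IsOpen ({x : b₁.carrier | ε x = ε p.1} ×ˢ Iio (-(2 * δ))) := hεopen.prod isOpen_Iio
      filter_upwards [ho.mem_nhds ⟨rfl, hp⟩] with q hq
      rw [hΛ q hq.2]
      have hq0 : q.2 < 0 := by have := hq.2; simp only [mem_Iio] at this; linarith
      show ε q.1 • ((S₂.collarLiouvilleForm Γ₂ (reindexBoundaryData b₂ ψ)).pullback ((𝓡 3).prod 𝓘(ℝ, ℝ))
        seamFlip) q = ε p.1 • ((-dComplex S₂.J S₂.φ).pullback ((𝓡 3).prod 𝓘(ℝ, ℝ)) ν) q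
      rw [show ε q.1 = ε p.1 from hq.1]
      congr 1
      exact MForm.pullback_pullback_apply (IA := (𝓡 3).prod 𝓘(ℝ, ℝ)) (-dComplex S₂.J S₂.φ)
        ((hμ (seamFlip q) (by simpa using hq0)).mdifferentiableAt (by simp))
        ((contMDiff_seamFlip q).mdifferentiableAt (by simp))
    rw [Literature.Geometry.Kaehler.mextDeriv_congr_of_eventuallyEq hev, mextDeriv_smul]
    show ε p.1 • mextDeriv ((-dComplex S₂.J S₂.φ).pullback ((𝓡 3).prod 𝓘(ℝ, ℝ)) ν) p = _
    congr 1
    refine mextDeriv_pullback_apply ?_ (S₂.isSmoothForm_liouvilleForm _)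
    filter_upwards [(isOpen_lt continuous_snd continuous_const).mem_nhds hp0] with q hq
    exact hνs q hq
  -- Step 2: LHS
  have hval : Function.invFun (seamEmb (steinGlueData Γ₁ b₁ Γ₂ b₂ ψ))
      (seamEmb (steinGlueData Γ₁ b₁ Γ₂ b₂ ψ) p) = p := Function.leftInverse_invFun hinjσ p
  have h2 := MForm.pullback_pullback_apply (IA := 𝓡 4) (mextDeriv (-dComplex S₂.J S₂.φ))
    (g := ν) (f := Function.invFun (seamEmb (steinGlueData Γ₁ b₁ Γ₂ b₂ ψ)))
    (x := seamEmb (steinGlueData Γ₁ b₁ Γ₂ b₂ ψ) p)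
    (by rw [hval]; exact (hνs p hp0).mdifferentiableAt (by simp)) ((hinvσ p).mdifferentiableAt (by simp))
  -- Step 3: RHS
  have hlc : ∀ y : W₂, ∀ᶠ y' in 𝓝 y, signExtension b₂ ψ g y' = signExtension b₂ ψ g y := fun y => by
    haveI : LocallyConnectedSpace W₂ := ChartedSpace.locallyConnectedSpace (EuclideanHalfSpace 4) W₂
    filter_upwards [isOpen_connectedComponent.mem_nhds mem_connectedComponent] with y' hy'
    exact signExtension_eq_of_mem_connectedComponent b₂ ψ g hy'
  have hne : ∀ y : W₂, signExtension b₂ ψ g y ≠ 0 := fun y => by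
    rcases signExtension_eq_or b₂ ψ g y with h | h <;> rw [h] <;> norm_num
  obtain ⟨-, -, -, h4⟩ := S₂.interiorKahler_package (ρ := signExtension b₂ ψ g)
    (contMDiff_signExtension b₂ ψ g) hlc hne
  set cpt : InteriorManifold (𝓡∂ 4) W₂ := C.inPt ((steinGlueData Γ₁ b₁ Γ₂ b₂ ψ).φ p.1, -p.2) with hcpt
  have hσι : seamEmb (steinGlueData Γ₁ b₁ Γ₂ b₂ ψ) p = intEmbN (steinGlueData Γ₁ b₁ Γ₂ b₂ ψ) cpt :=
    seamEmb_eq_intEmbN (steinGlueData Γ₁ b₁ Γ₂ b₂ ψ) hp0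
  -- the sign at `cpt`
  have hsign : signExtension b₂ ψ g cpt.val = ε p.1 := by
    have hv : cpt.val = C.toFun p.1 (-p.2) := C.inPt_val (p := ((steinGlueData Γ₁ b₁ Γ₂ b₂ ψ).φ p.1, -p.2))
      (by simpa using hp0)
    rw [hv, signExtension_eq_of_mem_connectedComponent b₂ ψ g
      (openCollar_mem_connectedComponent b₁ Γ₂ b₂ ψ p.1 (by linarith)), signExtension_incl S₂ b₂ ψ hgc hg0]
    by_cases h : 0 < g p.1
    · rw [if_pos h]; exact ((hεg p.1).1 h).symm
    · rw [if_neg h]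
      rcases hε1 p.1 with h1' | h1'
      · exact absurd ((hεg p.1).2 h1') h
      · exact h1'.symm
  have hτ : S₂.interiorKahler (signExtension b₂ ψ g)
      (Function.invFun (intEmbN (steinGlueData Γ₁ b₁ Γ₂ b₂ ψ)) (seamEmb (steinGlueData Γ₁ b₁ Γ₂ b₂ ψ) p)) =
      ((ε p.1) • ((mextDeriv (-dComplex S₂.J S₂.φ)).pullback 𝓘(ℝ, EuclideanSpace ℝ (Fin 4))
        (InteriorManifold.val : InteriorManifold (𝓡∂ 4) W₂ → W₂)))
      (Function.invFun (intEmbN (steinGlueData Γ₁ b₁ Γ₂ b₂ ψ)) (seamEmb (steinGlueData Γ₁ b₁ Γ₂ b₂ ψ) p)) := by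
    rw [hσι, Function.leftInverse_invFun hinjι, h4 cpt, hsign]
    rfl
  have h3 := MForm.pullback_pullback_apply (IA := 𝓡 4) (mextDeriv (-dComplex S₂.J S₂.φ))
    (g := (InteriorManifold.val : InteriorManifold (𝓡∂ 4) W₂ → W₂))
    (f := Function.invFun (intEmbN (steinGlueData Γ₁ b₁ Γ₂ b₂ ψ)))
    (x := seamEmb (steinGlueData Γ₁ b₁ Γ₂ b₂ ψ) p)
    ((InteriorManifold.contMDiff_val _).mdifferentiableAt (by simp))
    (by rw [hσι]; exact (hinvι _).mdifferentiableAt (by simp))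
  -- Step 4: the two maps agree near `σ p`
  have h5 : (ν ∘ Function.invFun (seamEmb (steinGlueData Γ₁ b₁ Γ₂ b₂ ψ)))
      =ᶠ[𝓝 (seamEmb (steinGlueData Γ₁ b₁ Γ₂ b₂ ψ) p)]
      ((InteriorManifold.val : InteriorManifold (𝓡∂ 4) W₂ → W₂) ∘
        Function.invFun (intEmbN (steinGlueData Γ₁ b₁ Γ₂ b₂ ψ))) := by
    filter_upwards [(hopenσ _ (isOpen_lt continuous_snd continuous_const)).mem_nhds
      (mem_image_of_mem _ hp0)] with q hq
    obtain ⟨q, hq0, rfl⟩ := hq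
    show ν (Function.invFun (seamEmb (steinGlueData Γ₁ b₁ Γ₂ b₂ ψ)) (seamEmb (steinGlueData Γ₁ b₁ Γ₂ b₂ ψ) q)) = _
    rw [Function.leftInverse_invFun hinjσ q]
    show C.toFun q.1 (-q.2) = (Function.invFun (intEmbN (steinGlueData Γ₁ b₁ Γ₂ b₂ ψ))
      (seamEmb (steinGlueData Γ₁ b₁ Γ₂ b₂ ψ) q)).val
    rw [seamEmb_eq_intEmbN (steinGlueData Γ₁ b₁ Γ₂ b₂ ψ) (show q.2 < 0 from hq0),
      Function.leftInverse_invFun hinjι]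
    exact (C.inPt_val (p := ((steinGlueData Γ₁ b₁ Γ₂ b₂ ψ).φ q.1, -q.2)) (by simpa using hq0)).symm
  -- assemble
  have hL : ((mextDeriv Λ).pullback (𝓡 4) (Function.invFun (seamEmb (steinGlueData Γ₁ b₁ Γ₂ b₂ ψ))))
      (seamEmb (steinGlueData Γ₁ b₁ Γ₂ b₂ ψ) p) =
    ((((ε p.1) • ((mextDeriv (-dComplex S₂.J S₂.φ)).pullback ((𝓡 3).prod 𝓘(ℝ, ℝ)) ν))).pullback
      (𝓡 4) (Function.invFun (seamEmb (steinGlueData Γ₁ b₁ Γ₂ b₂ ψ)))) (seamEmb (steinGlueData Γ₁ b₁ Γ₂ b₂ ψ) p) := by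
    refine MForm.pullback_congr_form ?_
    rw [hval]; exact h1
  have hR : ((S₂.interiorKahler (signExtension b₂ ψ g)).pullback (𝓡 4)
      (Function.invFun (intEmbN (steinGlueData Γ₁ b₁ Γ₂ b₂ ψ)))) (seamEmb (steinGlueData Γ₁ b₁ Γ₂ b₂ ψ) p) =
    ((((ε p.1) • ((mextDeriv (-dComplex S₂.J S₂.φ)).pullback 𝓘(ℝ, EuclideanSpace ℝ (Fin 4))
        (InteriorManifold.val : InteriorManifold (𝓡∂ 4) W₂ → W₂)))).pullback
      (𝓡 4) (Function.invFun (intEmbN (steinGlueData Γ₁ b₁ Γ₂ b₂ ψ)))) (seamEmb (steinGlueData Γ₁ b₁ Γ₂ b₂ ψ) p) :=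
    MForm.pullback_congr_form hτ
  have key : (((mextDeriv (-dComplex S₂.J S₂.φ)).pullback ((𝓡 3).prod 𝓘(ℝ, ℝ)) ν).pullback (𝓡 4)
      (Function.invFun (seamEmb (steinGlueData Γ₁ b₁ Γ₂ b₂ ψ)))) (seamEmb (steinGlueData Γ₁ b₁ Γ₂ b₂ ψ) p) =
    (((mextDeriv (-dComplex S₂.J S₂.φ)).pullback 𝓘(ℝ, EuclideanSpace ℝ (Fin 4))
      (InteriorManifold.val : InteriorManifold (𝓡∂ 4) W₂ → W₂)).pullback (𝓡 4)
      (Function.invFun (intEmbN (steinGlueData Γ₁ b₁ Γ₂ b₂ ψ)))) (seamEmb (steinGlueData Γ₁ b₁ Γ₂ b₂ ψ) p) :=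
    h2.trans ((MForm.pullback_congr_map _ h5).trans h3.symm)
  rw [hL, hR, MForm.pullback_smul, MForm.pullback_smul]
  exact congrArg (fun r : TangentSpace (𝓡 4) (seamEmb (steinGlueData Γ₁ b₁ Γ₂ b₂ ψ) p) [⋀^Fin 2]→L[ℝ] ℝ =>
    ε p.1 • r) key


/-- The seam primitive far on the first side is the collar form `α₁`. [folklore] -/
theorem seamGluePrimitive_of_gt {H : Type*} [TopologicalSpace H] [ChartedSpace (EuclideanSpace ℝ (Fin 3)) H]
    {δ : ℝ} (hδ : 0 < δ) (K : ℝ) (α₁ α₂ : MForm ((𝓡 3).prod 𝓘(ℝ, ℝ)) (H × ℝ) ℝ 1)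
    (β : MForm (𝓡 3) H ℝ 1) {q : H × ℝ} (hq : 2 * δ < q.2) :
    seamGluePrimitive δ K α₁ α₂ β q = α₁ q := by
  rw [seamGluePrimitive_apply, cutPlus_of_ge hδ hq.le, cutPlus_of_le hδ (by linarith)]
  simp

/-- The seam primitive far on the second side is the flipped collar form `α₂`. [folklore] -/
theorem seamGluePrimitive_of_lt {H : Type*} [TopologicalSpace H] [ChartedSpace (EuclideanSpace ℝ (Fin 3)) H]
    {δ : ℝ} (hδ : 0 < δ) (K : ℝ) (α₁ α₂ : MForm ((𝓡 3).prod 𝓘(ℝ, ℝ)) (H × ℝ) ℝ 1)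
    (β : MForm (𝓡 3) H ℝ 1) {q : H × ℝ} (hq : q.2 < -(2 * δ)) :
    seamGluePrimitive δ K α₁ α₂ β q = α₂ q := by
  rw [seamGluePrimitive_apply, cutPlus_of_le hδ (by linarith), cutPlus_of_ge hδ (by linarith)]
  simp

include hD₁ hD₂ in
/-- **The folded form on the Stein gluing.**  For two compact Stein domains with boundary data
`b₁`, `b₂`, a diffeomorphism `ψ : H = b₁.carrier ≅ b₂.carrier` under which the boundary plane
fields correspond, and Liouville open collars of the two pieces, the glued closed `4`-manifold
`P = W₁ ∪ (H × ℝ) ∪ W₂` (glue datum `steinGlueData`) carries a smooth closed `2`-form satisfying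
the transversality and maximal-rank clauses of Def. 1 along its fold (which is the seam
`H × {0}`): Baykur's form `ω₊ ∪ d((t² + 1) α) ∪ ω₋`, here `gluedForm` of the seam primitive
`seamGluePrimitive 1 K (CM^*λ₁) (ε · ν^*(CN^*λ₂)) (incl₁^*λ₁)`.
[cite: Baykur2006, Thm. 6.1] [cite: Cannasdasilva2010, Thm. 2] -/
theorem exists_def_one_steinGlue
    (hplane : ∀ z, Submodule.map (mfderiv (𝓡 3) (𝓡∂ 4) (b₂.incl ∘ ψ) z).toLinearMap
      (boundaryPlaneField S₁.J b₁ z) = contactPlane S₂.J (b₂.incl (ψ z))) :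
    ∃ s : MForm (𝓡 4) (steinGlueData Γ₁ b₁ Γ₂ b₂ ψ).d₂.Glued ℝ 2,
      IsSmoothForm s ∧ IsClosedForm s ∧
      (∀ z ∈ fold s, fderiv ℝ (fun y => pfaffian (s.inChart z y)) (extChartAt (𝓡 4) z z) ≠ 0) ∧
      (∀ z ∈ fold s, ∃ v : TangentSpace (𝓡 4) z, (∀ w, s z ![v, w] = 0) ∧
        fderiv ℝ (fun y => pfaffian (s.inChart z y)) (extChartAt (𝓡 4) z z) v ≠ 0) := by
  -- instances
  haveI : CompactSpace b₁.carrier := BoundaryData.compactSpace_carrier b₁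
  haveI : CompactSpace (reindexBoundaryData b₂ ψ).carrier := ‹CompactSpace b₁.carrier›
  obtain ⟨x₀⟩ := ‹Nonempty b₁.carrier›
  haveI : Nonempty (InteriorManifold (𝓡∂ 4) W₁) := ⟨(Γ₁.openCollar b₁).inPt (x₀, 1)⟩
  haveI : Nonempty (InteriorManifold (𝓡∂ 4) W₂) := ⟨(Γ₂.openCollar (reindexBoundaryData b₂ ψ)).inPt (x₀, 1)⟩
  -- the conformal factor and the sign
  obtain ⟨g, ε, G, hgc, hg0, hg, hεc, hε1, hεg, hεg1, hG0, hG⟩ :=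
    exists_conformal_sign S₁ S₂ b₁ b₂ ψ hplane
  -- constants (introduced without `set`, whose abstraction pass is expensive here)
  obtain ⟨B, hB⟩ : ∃ B : ℝ, B = max 1 G := ⟨_, rfl⟩
  obtain ⟨K, hK⟩ : ∃ K : ℝ, K = B + 4 + 1 := ⟨_, rfl⟩
  have hB0 : 0 ≤ B := by rw [hB]; exact le_trans zero_le_one (le_max_left _ _)
  have hB1 : (1 : ℝ) ≤ B := by rw [hB]; exact le_max_left _ _
  have hBG : G ≤ B := by rw [hB]; exact le_max_right _ _
  have hKB : B + 4 * (1 : ℝ) ^ 2 < K := by rw [hK]; norm_num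
  -- the forms
  let β : MForm (𝓡 3) b₁.carrier ℝ 1 := S₁.boundaryContactForm b₁
  let α₁ : MForm ((𝓡 3).prod 𝓘(ℝ, ℝ)) (b₁.carrier × ℝ) ℝ 1 := S₁.collarLiouvilleForm Γ₁ b₁
  let α₂ : MForm ((𝓡 3).prod 𝓘(ℝ, ℝ)) (b₁.carrier × ℝ) ℝ 1 :=
    S₂.flippedCollarForm Γ₂ (reindexBoundaryData b₂ ψ) ε
  let Λ : MForm ((𝓡 3).prod 𝓘(ℝ, ℝ)) (b₁.carrier × ℝ) ℝ 1 := seamGluePrimitive 1 K α₁ α₂ β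
  let τM : MForm (𝓡 4) (InteriorManifold (𝓡∂ 4) W₁) ℝ 2 := S₁.interiorKahler fun _ => 1
  let τN : MForm (𝓡 4) (InteriorManifold (𝓡∂ 4) W₂) ℝ 2 := S₂.interiorKahler (signExtension b₂ ψ g)
  -- the interior packages
  obtain ⟨hτMs, hτMc, hτMn, -⟩ := S₁.interiorKahler_package (ρ := fun _ => (1 : ℝ)) contMDiff_const
    (fun y => Eventually.of_forall fun _ => rfl) (fun _ => one_ne_zero)
  have hlc : ∀ y : W₂, ∀ᶠ y' in 𝓝 y, signExtension b₂ ψ g y' = signExtension b₂ ψ g y := fun y => by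
    haveI : LocallyConnectedSpace W₂ := ChartedSpace.locallyConnectedSpace (EuclideanHalfSpace 4) W₂
    filter_upwards [isOpen_connectedComponent.mem_nhds mem_connectedComponent] with y' hy'
    exact signExtension_eq_of_mem_connectedComponent b₂ ψ g hy'
  have hne : ∀ y : W₂, signExtension b₂ ψ g y ≠ 0 := fun y => by
    rcases signExtension_eq_or b₂ ψ g y with h | h <;> rw [h] <;> norm_num
  obtain ⟨hτNs, hτNc, hτNn, -⟩ := S₂.interiorKahler_package (ρ := signExtension b₂ ψ g)
    (contMDiff_signExtension b₂ ψ g) hlc hne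
  -- the glued form
  refine ⟨gluedForm (steinGlueData Γ₁ b₁ Γ₂ b₂ ψ) 1 Λ τM τN, ?_⟩
  refine def_one_gluedForm (steinGlueData Γ₁ b₁ Γ₂ b₂ ψ) one_pos hτMs hτMc hτMn hτNs hτNc hτNn
    (fun p hp _ => ?_) (fun p _ hp => ?_) (fun p _ _ => ?_)
  · -- first overlap
    refine stitch_compat_M S₁ Γ₁ b₁ Γ₂ b₂ ψ one_pos (fun q hq => ?_) p hp
    exact seamGluePrimitive_of_gt one_pos K α₁ α₂ β hq
  · -- second overlap
    refine stitch_compat_N Γ₁ b₁ S₂ Γ₂ b₂ ψ one_pos hgc hg0 hεc hε1 hεg1 (fun q hq => ?_) p hp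
    exact seamGluePrimitive_of_lt one_pos K α₁ α₂ β hq
  · -- the flat data over the seam
    have hεg' : ∀ x, 0 < ε x * g x := hεg
    refine seamGluePrimitive_flatData one_pos hKB hB0 (S₁.isSmoothForm_boundaryContactForm b₁)
      (fun h₀ u hu => S₁.sliceContactVolume_flatSliceCovector_ne_zero hD₁ Γ₁ b₁ h₀ hu)
      (F₁ := fun h₀ => S₁.flatCollarFactor Γ₁ b₁ c₀ c₁ h₀)
      (F₂ := fun h₀ => S₂.flatFlippedFactor Γ₂ (reindexBoundaryData b₂ ψ) c₀' c₁' g ε h₀)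
      (fun h₀ => ⟨S₁.contDiffOn_flatCollarFactor hD₁ Γ₁ b₁ h₀, fun u hu hu0 => ⟨?_, ?_, ?_, ?_⟩⟩)
      (fun h₀ => ⟨?_, fun u hu hu0 => ⟨?_, ?_, ?_, ?_⟩⟩) p
    · exact S₁.flatCollarFactor_pos Γ₁ b₁ c₀ c₁ h₀ u
    · exact (S₁.flatCollarFactor_le_one hD₁ Γ₁ b₁ h₀ hu0.le).trans hB1
    · exact S₁.fderiv_flatCollarFactor_stdVec_zero_neg hD₁ Γ₁ b₁ h₀ hu hu0
    · exact S₁.flatRep_collarLiouvilleForm_eq_genFoldPrimitive hD₁ Γ₁ b₁ h₀ hu hu0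
    · exact S₂.contDiffOn_flatFlippedFactor hD₂ Γ₂ (reindexBoundaryData b₂ ψ)
        (S₁.isSmoothForm_boundaryContactForm b₁) (S₁.exists_boundaryContactForm_ne_zero b₁) hg hεc h₀
    · exact S₂.flatFlippedFactor_pos Γ₂ (reindexBoundaryData b₂ ψ) hεg' h₀ u
    · exact (S₂.flatFlippedFactor_le hD₂ Γ₂ (reindexBoundaryData b₂ ψ) hεg' hG h₀ hu0.le).trans hBG
    · exact S₂.fderiv_flatFlippedFactor_stdVec_zero_pos hD₂ Γ₂ (reindexBoundaryData b₂ ψ)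
        (S₁.isSmoothForm_boundaryContactForm b₁) (S₁.exists_boundaryContactForm_ne_zero b₁) hg hεc hεg'
        h₀ hu hu0
    · exact S₂.flatRep_flippedCollarForm_eq hD₂ Γ₂ (reindexBoundaryData b₂ ψ) hg ε h₀ hu hu0

end Stitch


/-! ### Theorem 2 from the Kähler decomposition

Baykur's proof of Cannas da Silva's Theorem 2 ([cite: Baykur2006, Thm. 6.1]): decompose the
closed connected orientable `X` as a Stein gluing `W₁ ∪_ψ W₂` with matching boundary plane fields
([cite: Baykur2006, Thm. 5.1], the tree's named fact `baykur_kahlerDecomposition`), put the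
folded form `exists_def_one_steinGlue` on the model gluing `P`, and transport it to `X ≅ P`
(uniqueness of gluings). -/

section FromKahlerDecomposition

/-- A boundary gluing along `ψ` is a boundary gluing along the identity of the re-indexed
datum. [folklore] -/
theorem isBoundaryGluing_reindex {W₁ : Type} [TopologicalSpace W₁] [ChartedSpace (EuclideanHalfSpace 4) W₁]
    {W₂ : Type} [TopologicalSpace W₂] [ChartedSpace (EuclideanHalfSpace 4) W₂] [IsManifold (𝓡∂ 4) ∞ W₂]
    {b₁ : BoundaryData (𝓡∂ 4) W₁ (𝓡 3)} {b₂ : BoundaryData (𝓡∂ 4) W₂ (𝓡 3)}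
    (ψ : b₁.carrier ≃ₘ⟮𝓡 3, 𝓡 3⟯ b₂.carrier) {X : Type} [TopologicalSpace X]
    [ChartedSpace (EuclideanSpace ℝ (Fin 4)) X] (h : IsBoundaryGluing b₁ b₂ ψ (𝓡 4) X) :
    IsBoundaryGluing b₁ (reindexBoundaryData b₂ ψ) (Diffeomorph.refl (𝓡 3) b₁.carrier ∞) (𝓡 4) X :=
  IsClosedGluing.congr h fun _ _ => Iff.rfl

/-- The pieces of a boundary gluing into a Hausdorff manifold are Hausdorff. [folklore] -/
theorem IsBoundaryGluing.t2Space_pieces {W₁ : Type} [TopologicalSpace W₁] [ChartedSpace (EuclideanHalfSpace 4) W₁]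
    {W₂ : Type} [TopologicalSpace W₂] [ChartedSpace (EuclideanHalfSpace 4) W₂]
    {b₁ : BoundaryData (𝓡∂ 4) W₁ (𝓡 3)} {b₂ : BoundaryData (𝓡∂ 4) W₂ (𝓡 3)}
    {ψ : b₁.carrier → b₂.carrier} {X : Type} [TopologicalSpace X] [T2Space X]
    [ChartedSpace (EuclideanSpace ℝ (Fin 4)) X] (h : IsBoundaryGluing b₁ b₂ ψ (𝓡 4) X) :
    T2Space W₁ ∧ T2Space W₂ := by
  obtain ⟨jA, jB, hA, hB, -, -⟩ := h
  exact ⟨hA.isEmbedding.t2Space, hB.isEmbedding.t2Space⟩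

/-- A non-empty compact Stein domain has non-empty boundary datum. [cite: Etnyre2004, Thm. 4.1] -/
theorem SteinStructure.nonempty_carrier {W : Type} [TopologicalSpace W] [ChartedSpace (EuclideanHalfSpace 4) W]
    [IsManifold (𝓡∂ 4) ∞ W] [CompactSpace W] [T2Space W] [Nonempty W] (S : SteinStructure W)
    (b : BoundaryData (𝓡∂ 4) W (𝓡 3)) : Nonempty b.carrier := by
  obtain ⟨w⟩ := ‹Nonempty W›
  obtain ⟨y, hy, -⟩ := (S.isPreconnected_boundary_inter_compOpens (ConnectedComponents.mk w)).2
  rw [← b.range_incl] at hy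
  obtain ⟨x, -⟩ := hy
  exact ⟨x⟩

/-- **Cannas da Silva's Theorem 2 from Baykur's Kähler decomposition.**  Assuming the named fact
`baykur_kahlerDecomposition` ([cite: Baykur2006, Thm. 5.1]), every compact orientable
`4`-manifold carries a folded symplectic form: on each component, decompose
`X = W₁ ∪_ψ W₂` into Stein pieces with matching boundary plane fields, glue Baykur's form
`ω₊ ∪ d((t² + 1)α) ∪ ω₋` on the model gluing (`exists_def_one_steinGlue`), transport it along the
diffeomorphism `X ≅ P` (uniqueness of gluings, `nonempty_diffeomorph_of_isBoundaryGluing_holds`;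
Def. 1 is diffeomorphism invariant, `def_one_pullback_diffeomorph`), and assemble the components
(`cannasDaSilva2010_foldedForm_of_orientable_of_connected`).
[cite: Baykur2006, Thm. 6.1] [cite: Cannasdasilva2010, Thm. 2] -/
theorem cannasDaSilva2010_foldedForm_of_orientable_of_kahlerDecomposition
    (hB : baykur_kahlerDecomposition) : CannasDaSilva2010_foldedForm_of_orientable := by
  refine cannasDaSilva2010_foldedForm_of_orientable_of_connected fun X _ _ _ _ _ _ _ hX => ?_
  -- the decomposition
  obtain ⟨W₁, _, _, _, _, W₂, _, _, _, _, S₁, S₂, b₁, b₂, ψ, hplane, hglue⟩ := hB X hX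
  obtain ⟨hT₁, hT₂⟩ := IsBoundaryGluing.t2Space_pieces hglue
  haveI := hT₁
  haveI := hT₂
  -- the common boundary is non-empty
  haveI : Nonempty b₁.carrier := by
    obtain ⟨x⟩ := (inferInstance : Nonempty X)
    obtain ⟨jA, jB, -, -, hU, -⟩ := hglue
    have hx : x ∈ range jA ∪ range jB := by rw [hU]; exact mem_univ x
    rcases hx with ⟨a, -⟩ | ⟨c, -⟩
    · haveI : Nonempty W₁ := ⟨a⟩
      exact S₁.nonempty_carrier b₁
    · haveI : Nonempty W₂ := ⟨c⟩
      obtain ⟨y⟩ := S₂.nonempty_carrier b₂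
      exact ⟨ψ.symm y⟩
  -- Liouville collars of the two pieces
  obtain ⟨c₀, hc₀, hreg⟩ := S₁.exists_liouvilleFlowout_params
  obtain ⟨c₀', hc₀', hreg'⟩ := S₂.exists_liouvilleFlowout_params
  have hc : c₀ < (c₀ + sSup (range S₁.φ)) / 2 := by linarith
  have hc₁ : (c₀ + sSup (range S₁.φ)) / 2 < sSup (range S₁.φ) := by linarith
  have hc' : c₀' < (c₀' + sSup (range S₂.φ)) / 2 := by linarith
  have hc₁' : (c₀' + sSup (range S₂.φ)) / 2 < sSup (range S₂.φ) := by linarith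
  obtain ⟨Γ₁⟩ := (S₁.liouvilleFlowout hc hc₁ hreg).nonempty_cover
  obtain ⟨Γ₂⟩ := (S₂.liouvilleFlowout hc' hc₁' hreg').nonempty_cover
  -- the folded form on the model gluing
  obtain ⟨t, hts, htc, -, htmax⟩ := exists_def_one_steinGlue S₁ rfl Γ₁ b₁ S₂ rfl Γ₂ b₂ ψ hplane
  -- `X ≅ P`
  have hP : IsBoundaryGluing b₁ (reindexBoundaryData b₂ ψ) (steinGlueData Γ₁ b₁ Γ₂ b₂ ψ).φ (𝓡 4)
      (steinGlueData Γ₁ b₁ Γ₂ b₂ ψ).d₂.Glued :=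
    (steinGlueData Γ₁ b₁ Γ₂ b₂ ψ).isBoundaryGluing
  have hXg : IsBoundaryGluing b₁ (reindexBoundaryData b₂ ψ) (steinGlueData Γ₁ b₁ Γ₂ b₂ ψ).φ (𝓡 4) X :=
    isBoundaryGluing_reindex ψ hglue
  obtain ⟨Φ⟩ := nonempty_diffeomorph_of_isBoundaryGluing_holds hXg hP
  -- transport
  obtain ⟨h1, h2, -, h3, h4⟩ := def_one_pullback_diffeomorph Φ hts htc htmax
  exact ⟨t.pullback (𝓡 4) Φ, h1, h2, h3, h4⟩

end FromKahlerDecomposition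

end Literature.Geometry.Symplectic

end
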